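import Summits.QuantumFields.BalabanUV.Beta.D1BFx.FibredPeriodisation
import Literature.MathematicalPhysics.QuantumFieldTheory.Balaban1983to89.Beta.Composition

/-!
# `BalabanUV.Beta.D1BFx.SortedKernels` — road «BF-x», binder row D1, slot (K), debt X₃(ii) ROUTE T (torus route), brick
# **TA1 «MULTI-SORTED PERIODISATION + BORDERED LEMMA 2.2.2»** of `HOME/b2b-balaban-beta-d1-p2/K-ASSEMBLY-SPEC.md` v1 §1, PART 1 (generic):
# SORTS AS FIBRES — block packing of fibred kernels along a SUM of fibre types, its composition rule, «periodisation commutes with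
# packing» (`fromBlocks` ∕ `kkt` ∕ `fromRows` of the periodised blocks = the periodisation of the packed `ℤ^d` operator, re-indexed), and
# the BORDERED block-periodic Lemma 2.2.2: a two-sided `ℤ^d` inverse of a packed (bordered) operator periodises to THE inverse of the
# torus block matrix, block by block

WHY (K-ASSEMBLY-SPEC v1 §1, brick TA1; OWNER-MEMO-g4 §3 steps (4)–(5)).  ROUTE T applies the LANDED matrix identity
`SliceTransferJetsMixed.mixedVar_sliceTransfer_jets` on each cubic torus to the block matrices `M_T = kkt K̂₀ (fromRows Q̂₀ τ_T)`,
`N_T = kkt (K̂₀ + P̂₀ᵀP̂₀) Q̂₀` whose index sorts are fine bonds, coarse bonds and comb rows.  The cell's periodisation machinery (an4's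
`EntrywiseVolumeLimit.periodise₂`, this lineage's `FibredPeriodisation.periodiseF`) is ONE-sorted: kernels on `ℤ^d × (fibre)`.  THE DESIGN OF
TA1: the sorts are FIBRES over ONE base lattice — a 2 × 2 (resp. 3 × 3) block operator between sorts with fibres `α`, `β` (resp. `γ`) is ONE
fibred kernel with fibre `α ⊕ β` (resp. nested), so that `periodiseF`, the product rule `periodiseF_compF` and `lemma222F` apply VERBATIM,
and the torus block matrices of the model are recovered by the re-indexing `Site d s × (α ⊕ β) ≃ (Site d s × α) ⊕ (Site d s × β)`
(`Equiv.prodSumDistrib`).  PART 2 (`SortedReblocking`) puts the road's three sorts (fine bonds = fibre `(ℤ∕n)^{d} × Fin d` over the COARSE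
lattice by re-blocking, coarse bonds = fibre `Fin d`, comb rows) into this form and bridges to the cell's embedded `MKer (d+1) (Fib d)` kernels.

CONTENT (all [folklore] ∕ [our object]; every `d`, torus `Site d s = (ℤ∕s)^d`, `s ≥ 1`; fibre types arbitrary, finite where summed):
* §1 [our object] the PACKER `fpack A B C D : FKer d (α ⊕ β) (α′ ⊕ β′)`, block READERS `fTL fTR fBL fBR`, `fpack_eta`, fibre readers
  `Kfib_fpack_*`; the fibred transpose `trF`; [folklore] **`compF_fpack`** (block composition rule, finite Fubini
  over the fibre sum), `kdeltaF_eq_fpack`, negation∕zero bookkeeping.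
* §2 [folklore] PERIODISATION COMMUTES WITH PACKING: `periodiseF_fpack_*` (entrywise, `rfl`), **`reindex_periodiseF_fpack`**
  (`reindex e e′ (of (periodiseF s (fpack A B C D))) = fromBlocks Â B̂ Ĉ D̂`), `periodiseF_trF`
  (`= (·)ᵀ`, jointly periodic fibres), `periodiseF_zero`; hence **`kkt_periodiseF`**: `kkt Ĥ Q̂ = reindex e e (of (periodiseF s (fpack H (trF Q) Q 0)))`.
* §3 [folklore] HYPOTHESES SPLIT ALONG THE BLOCKS: `summable_abs_fpack`, `isPeriodic₂_fpack`, `rowBound_fpack` (and `rowBound_mono`).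
* §4 [folklore] **BORDERED LEMMA 2.2.2** `lemma222_fpack`: for `T S : FKer d (α ⊕ β) (α ⊕ β)` with `compF T S = kdeltaF` (rows of `T` absolutely
  summable, fibres of `S` jointly `s`-periodic with a row bound) the block matrices satisfy `T̂·Ŝ = 1 ∧ Ŝ·T̂ = 1` on `(Site d s × α) ⊕ (Site d s × β)`;
  **`eq_blocks_periodiseF_of_mul_eq_one`** (ANY torus right inverse of `T̂` IS `Ŝ`); the KKT FORMS **`kkt_periodiseF_mul_eq_one`** ∕
  **`kkt_periodiseF_inv`**: `(kkt Ĥ Q̂)⁻¹ = fromBlocks Ŝ₁₁ Ŝ₁₂ Ŝ₂₁ Ŝ₂₂` — so bricks TB1∕TB2 only owe the `ℤ^d` identity `compF (fpack H Qᵀ Q 0) S = δ`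
  for their letters (X₁a-type inputs), nothing on the torus.
NOT HERE (honest): the road's letters; the re-blocking of fine `ℤ⁴` kernels and the comb sort (PART 2); TA2's arrays; any estimate.

HONEST FRAMING (cell contract, verbatim): «discharging `BetaPertH` makes Bałaban's UV stability UNCONDITIONAL — a real constructive-QFT
result; it is NOT the continuum limit and NOT the Clay problem.»  HONEST DEPENDENCY (verbatim): «continuum YM on T⁴ ⇐ BetaPertH ∧ nine
spine estimates (0/9 proved); BetaPertH ⇐ (D1) ∧ (D4) ∧ CAP+tail; G-an2-4 gates asym, D1 and NE2/3/4.»  [folklore] bookkeeping over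
`FibredPeriodisation` (`periodiseF`, `periodiseF_compF_matrix`, `lemma222F`, `periodiseF_transpose`, `periodise₂_zero`) and Mathlib's
`Matrix.fromBlocks`∕`Matrix.submatrix` BY NAME; no `Prop` is minted, nothing is cited, no wall binder is instantiated; 0 sorry.  NOT D1, NOT
BetaPertH, NOT summit progress.  ABSOLUTE RULE (cell, verbatim): «No internally-minted statement may enter as a cited fact. Every hypothesis is
either kernel-proved in this package or a verbatim quotation of a PUBLISHED theorem with page reference. The manuscript(s) under audit are NOT
citable for their own disputed steps — they are the thing under adjudication; programme-internal (2001/route/tribunal) claims are never citable.»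
Provenance: D1 formalisation swarm, unit `b2b-balaban-beta-d1-formalise-leaf-03` (gen 8), claim «K-TA1», 2026-08-20.
-/

noncomputable section

namespace Summit.QuantumFields.BalabanUV.Beta.D1BFx.SortedKernels

open Literature.MathematicalPhysics.QuantumFieldTheory.Balaban1983to89
open Literature.MathematicalPhysics.QuantumFieldTheory.Balaban1983to89.Beta
open Literature.MathematicalPhysics.QuantumFieldTheory.Balaban1983to89.Beta.Composition (kkt)
open Summit.QuantumFields.BalabanUV.Beta.D1BFx.FibredPeriodisation
open scoped BigOperators Matrix

variable {d : ℕ} {α β γ α' β' α'' β'' : Type*}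

/-! ## §1 Packing fibred kernels along a sum of fibres -/

/-- [our object] **THE PACKER**: the block operator `[[A, B], [C, D]]` between the sorts `α ⊕ β → α′ ⊕ β′` as ONE fibred kernel. -/
def fpack (A : FKer d α α') (B : FKer d α β') (C : FKer d β α') (D : FKer d β β') : FKer d (α ⊕ β) (α' ⊕ β')
  | (x, Sum.inl a), (y, Sum.inl a') => A (x, a) (y, a')
  | (x, Sum.inl a), (y, Sum.inr b') => B (x, a) (y, b')
  | (x, Sum.inr b), (y, Sum.inl a') => C (x, b) (y, a')
  | (x, Sum.inr b), (y, Sum.inr b') => D (x, b) (y, b')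

/-- [our object] Top-left block reader. -/
def fTL (K : FKer d (α ⊕ β) (α' ⊕ β')) : FKer d α α' := fun i j => K (i.1, Sum.inl i.2) (j.1, Sum.inl j.2)
/-- [our object] Top-right block reader. -/
def fTR (K : FKer d (α ⊕ β) (α' ⊕ β')) : FKer d α β' := fun i j => K (i.1, Sum.inl i.2) (j.1, Sum.inr j.2)
/-- [our object] Bottom-left block reader. -/
def fBL (K : FKer d (α ⊕ β) (α' ⊕ β')) : FKer d β α' := fun i j => K (i.1, Sum.inr i.2) (j.1, Sum.inl j.2)
/-- [our object] Bottom-right block reader. -/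
def fBR (K : FKer d (α ⊕ β) (α' ⊕ β')) : FKer d β β' := fun i j => K (i.1, Sum.inr i.2) (j.1, Sum.inr j.2)

section Pack
variable (A : FKer d α α') (B : FKer d α β') (C : FKer d β α') (D : FKer d β β')

/-- [our object] Unfolding, `inl∕inl`. -/
@[simp] theorem fpack_inl_inl (x y : Fin d → ℤ) (a : α) (a' : α') : fpack A B C D (x, Sum.inl a) (y, Sum.inl a') = A (x, a) (y, a') := rfl
/-- [our object] Unfolding, `inl∕inr`. -/
@[simp] theorem fpack_inl_inr (x y : Fin d → ℤ) (a : α) (b' : β') : fpack A B C D (x, Sum.inl a) (y, Sum.inr b') = B (x, a) (y, b') := rfl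
/-- [our object] Unfolding, `inr∕inl`. -/
@[simp] theorem fpack_inr_inl (x y : Fin d → ℤ) (b : β) (a' : α') : fpack A B C D (x, Sum.inr b) (y, Sum.inl a') = C (x, b) (y, a') := rfl
/-- [our object] Unfolding, `inr∕inr`. -/
@[simp] theorem fpack_inr_inr (x y : Fin d → ℤ) (b : β) (b' : β') : fpack A B C D (x, Sum.inr b) (y, Sum.inr b') = D (x, b) (y, b') := rfl

/-- [our object] Reading back the top-left block. -/
@[simp] theorem fTL_fpack : fTL (fpack A B C D) = A := rfl
/-- [our object] Reading back the top-right block. -/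
@[simp] theorem fTR_fpack : fTR (fpack A B C D) = B := rfl
/-- [our object] Reading back the bottom-left block. -/
@[simp] theorem fBL_fpack : fBL (fpack A B C D) = C := rfl
/-- [our object] Reading back the bottom-right block. -/
@[simp] theorem fBR_fpack : fBR (fpack A B C D) = D := rfl

/-- [our object] Fibres of the packer, `inl∕inl`. -/
theorem Kfib_fpack_inl_inl (a : α) (a' : α') : Kfib (fpack A B C D) (Sum.inl a) (Sum.inl a') = Kfib A a a' := rfl
/-- [our object] Fibres of the packer, `inl∕inr`. -/
theorem Kfib_fpack_inl_inr (a : α) (b' : β') : Kfib (fpack A B C D) (Sum.inl a) (Sum.inr b') = Kfib B a b' := rfl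
/-- [our object] Fibres of the packer, `inr∕inl`. -/
theorem Kfib_fpack_inr_inl (b : β) (a' : α') : Kfib (fpack A B C D) (Sum.inr b) (Sum.inl a') = Kfib C b a' := rfl
/-- [our object] Fibres of the packer, `inr∕inr`. -/
theorem Kfib_fpack_inr_inr (b : β) (b' : β') : Kfib (fpack A B C D) (Sum.inr b) (Sum.inr b') = Kfib D b b' := rfl

end Pack

/-- [our object] A kernel between sum fibres IS the packing of its four blocks. -/
theorem fpack_eta (K : FKer d (α ⊕ β) (α' ⊕ β')) : fpack (fTL K) (fTR K) (fBL K) (fBR K) = K := by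
  funext ⟨x, i⟩ ⟨y, j⟩
  rcases i with a | b <;> rcases j with a' | b' <;> rfl

/-- [our object] Two packings agree iff the blocks agree. -/
theorem fpack_inj_iff {A A₁ : FKer d α α'} {B B₁ : FKer d α β'} {C C₁ : FKer d β α'} {D D₁ : FKer d β β'} :
    fpack A B C D = fpack A₁ B₁ C₁ D₁ ↔ A = A₁ ∧ B = B₁ ∧ C = C₁ ∧ D = D₁ := by
  constructor
  · intro h
    exact ⟨by rw [← fTL_fpack A B C D, h, fTL_fpack], by rw [← fTR_fpack A B C D, h, fTR_fpack],
      by rw [← fBL_fpack A B C D, h, fBL_fpack], by rw [← fBR_fpack A B C D, h, fBR_fpack]⟩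
  · rintro ⟨rfl, rfl, rfl, rfl⟩; rfl

/-- [our object] **FIBRED TRANSPOSE** `Kᵀ((x,a),(y,b)) := K((y,b),(x,a))`. -/
def trF (K : FKer d α β) : FKer d β α := fun i j => K j i

/-- [our object] Unfolding of `trF`. -/
@[simp] theorem trF_apply (K : FKer d α β) (i : (Fin d → ℤ) × β) (j : (Fin d → ℤ) × α) : trF K i j = K j i := rfl

/-- [folklore] **BLOCK COMPOSITION RULE**: `[[A,B],[C,D]] ∘ [[A′,B′],[C′,D′]] = [[AA′ + BC′, AB′ + BD′],[CA′ + DC′, CB′ + DD′]]` — the fibre sum of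
`compF` splits along `α′ ⊕ β′` (finite Fubini; no summability needed). -/
theorem compF_fpack [Fintype α'] [Fintype β'] (A : FKer d α α') (B : FKer d α β') (C : FKer d β α') (D : FKer d β β')
    (A' : FKer d α' α'') (B' : FKer d α' β'') (C' : FKer d β' α'') (D' : FKer d β' β'') :
    compF (fpack A B C D) (fpack A' B' C' D')
      = fpack (compF A A' + compF B C') (compF A B' + compF B D') (compF C A' + compF D C') (compF C B' + compF D D') := by
  funext ⟨x, i⟩ ⟨z, k⟩
  rcases i with a | b <;> rcases k with a'' | b'' <;>
    simp only [compF, Fintype.sum_sum_type, fpack_inl_inl, fpack_inl_inr, fpack_inr_inl, fpack_inr_inr, Pi.add_apply]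

/-- [folklore] The fibred Kronecker kernel of a sum fibre is block diagonal: `δ_{α ⊕ β} = [[δ_α, 0],[0, δ_β]]`. -/
theorem kdeltaF_eq_fpack [DecidableEq α] [DecidableEq β] :
    (kdeltaF : FKer d (α ⊕ β) (α ⊕ β)) = fpack kdeltaF (fun _ _ => 0) (fun _ _ => 0) kdeltaF := by
  funext ⟨x, i⟩ ⟨y, j⟩
  rcases i with a | b <;> rcases j with a' | b' <;> simp [kdeltaF]

/-! ## §2 Periodisation commutes with packing -/

section Periodise
variable {s : ℕ} [NeZero s]
variable (A : FKer d α α') (B : FKer d α β') (C : FKer d β α') (D : FKer d β β')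

/-- [folklore] Periodised packed kernel, `inl∕inl` entries. -/
theorem periodiseF_fpack_inl_inl (x y : Site d s) (a : α) (a' : α') :
    periodiseF s (fpack A B C D) (x, Sum.inl a) (y, Sum.inl a') = periodiseF s A (x, a) (y, a') := rfl
/-- [folklore] Periodised packed kernel, `inl∕inr` entries. -/
theorem periodiseF_fpack_inl_inr (x y : Site d s) (a : α) (b' : β') :
    periodiseF s (fpack A B C D) (x, Sum.inl a) (y, Sum.inr b') = periodiseF s B (x, a) (y, b') := rfl
/-- [folklore] Periodised packed kernel, `inr∕inl` entries. -/
theorem periodiseF_fpack_inr_inl (x y : Site d s) (b : β) (a' : α') :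
    periodiseF s (fpack A B C D) (x, Sum.inr b) (y, Sum.inl a') = periodiseF s C (x, b) (y, a') := rfl
/-- [folklore] Periodised packed kernel, `inr∕inr` entries. -/
theorem periodiseF_fpack_inr_inr (x y : Site d s) (b : β) (b' : β') :
    periodiseF s (fpack A B C D) (x, Sum.inr b) (y, Sum.inr b') = periodiseF s D (x, b) (y, b') := rfl

/-- [folklore] **PERIODISATION COMMUTES WITH PACKING**: re-indexed along `Site d s × (α ⊕ β) ≃ (Site d s × α) ⊕ (Site d s × β)` the torus
matrix of the packed kernel is the block matrix of the torus matrices of the blocks. -/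
theorem reindex_periodiseF_fpack :
    Matrix.reindex (Equiv.prodSumDistrib (Site d s) α β) (Equiv.prodSumDistrib (Site d s) α' β')
        (Matrix.of (periodiseF s (fpack A B C D)))
      = Matrix.fromBlocks (Matrix.of (periodiseF s A)) (Matrix.of (periodiseF s B))
          (Matrix.of (periodiseF s C)) (Matrix.of (periodiseF s D)) := by
  ext i j
  rcases i with ⟨x, a⟩ | ⟨x, b⟩ <;> rcases j with ⟨y, a'⟩ | ⟨y, b'⟩ <;>
    simp only [Matrix.reindex_apply, Matrix.submatrix_apply, Equiv.prodSumDistrib_symm_apply_left,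
      Equiv.prodSumDistrib_symm_apply_right, Matrix.of_apply, Matrix.fromBlocks_apply₁₁, Matrix.fromBlocks_apply₁₂,
      Matrix.fromBlocks_apply₂₁, Matrix.fromBlocks_apply₂₂] <;> rfl

/-- [folklore] The periodisation of the zero kernel is the zero matrix. -/
theorem periodiseF_zero : Matrix.of (periodiseF s (fun _ _ => (0 : ℝ) : FKer d α β)) = 0 := by
  ext ⟨x, a⟩ ⟨y, b⟩
  rw [Matrix.of_apply, periodiseF_apply, Matrix.zero_apply]
  exact periodise₂_zero x y

/-- [folklore] The periodisation of the fibred transpose is the transpose (jointly periodic fibres). -/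
theorem periodiseF_trF {Q : FKer d α β} (hQ : ∀ a b, IsPeriodic₂ s (Kfib Q a b)) :
    Matrix.of (periodiseF s (trF Q)) = (Matrix.of (periodiseF s Q))ᵀ := by
  ext ⟨y, b⟩ ⟨x, a⟩
  rw [Matrix.of_apply, Matrix.transpose_apply, Matrix.of_apply]
  exact periodiseF_transpose hQ x y a b

/-- [folklore] Entrywise transpose rule. -/
theorem periodiseF_trF_apply {Q : FKer d α β} (hQ : ∀ a b, IsPeriodic₂ s (Kfib Q a b)) (x y : Site d s) (b : β) (a : α) :
    periodiseF s (trF Q) (x, b) (y, a) = periodiseF s Q (y, a) (x, b) :=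
  periodiseF_transpose hQ y x a b

/-- [folklore] Entries of the periodised zero kernel vanish. -/
theorem periodiseF_zero_apply (i : Site d s × α) (j : Site d s × β) : periodiseF s (fun _ _ => (0 : ℝ) : FKer d α β) i j = 0 :=
  periodise₂_zero i.1 j.1

/-- [folklore] **THE TORUS KKT MATRIX IS A PERIODISED PACKED KERNEL**: `kkt Ĥ Q̂ = reindex e e ((fpack H Qᵀ Q 0)^)` (fibres of `Q` jointly
`s`-periodic, for the transpose rule). -/
theorem kkt_periodiseF (H : FKer d α α) {Q : FKer d β α} (hQ : ∀ b a, IsPeriodic₂ s (Kfib Q b a)) :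
    kkt (Matrix.of (periodiseF s H)) (Matrix.of (periodiseF s Q))
      = Matrix.reindex (Equiv.prodSumDistrib (Site d s) α β) (Equiv.prodSumDistrib (Site d s) α β)
          (Matrix.of (periodiseF s (fpack H (trF Q) Q (fun _ _ => 0)))) := by
  rw [reindex_periodiseF_fpack, periodiseF_trF hQ, periodiseF_zero]
  rfl

end Periodise

/-! ## §3 The hypotheses of Lemma 2.2.2 split along the blocks -/

section Hyps
variable {s : ℕ}
variable {A : FKer d α α'} {B : FKer d α β'} {C : FKer d β α'} {D : FKer d β β'}

/-- [folklore] Absolute row summability of every fibre of a packed kernel from that of the blocks. -/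
theorem summable_abs_fpack (hA : ∀ a a' x, Summable fun y => |Kfib A a a' x y|) (hB : ∀ a b' x, Summable fun y => |Kfib B a b' x y|)
    (hC : ∀ b a' x, Summable fun y => |Kfib C b a' x y|) (hD : ∀ b b' x, Summable fun y => |Kfib D b b' x y|) :
    ∀ i k x, Summable fun y => |Kfib (fpack A B C D) i k x y| := by
  rintro (a | b) (a' | b') x
  exacts [hA a a' x, hB a b' x, hC b a' x, hD b b' x]

/-- [folklore] Plain row summability of every fibre of a packed kernel from that of the blocks. -/
theorem summable_fpack (hA : ∀ a a' x, Summable (Kfib A a a' x)) (hB : ∀ a b' x, Summable (Kfib B a b' x))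
    (hC : ∀ b a' x, Summable (Kfib C b a' x)) (hD : ∀ b b' x, Summable (Kfib D b b' x)) :
    ∀ i k x, Summable (Kfib (fpack A B C D) i k x) := by
  rintro (a | b) (a' | b') x
  exacts [hA a a' x, hB a b' x, hC b a' x, hD b b' x]

/-- [folklore] Joint `s`-periodicity of every fibre of a packed kernel from that of the blocks. -/
theorem isPeriodic₂_fpack (hA : ∀ a a', IsPeriodic₂ s (Kfib A a a')) (hB : ∀ a b', IsPeriodic₂ s (Kfib B a b'))
    (hC : ∀ b a', IsPeriodic₂ s (Kfib C b a')) (hD : ∀ b b', IsPeriodic₂ s (Kfib D b b')) :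
    ∀ i k, IsPeriodic₂ s (Kfib (fpack A B C D) i k) := by
  rintro (a | b) (a' | b')
  exacts [hA a a', hB a b', hC b a', hD b b']

/-- [folklore] A row bound may be enlarged. -/
theorem rowBound_mono {K : Kernel₂ d} {B₁ B₂ : ℝ} (h : RowBound K B₁) (h12 : B₁ ≤ B₂) : RowBound K B₂ :=
  fun x => ⟨(h x).1, (h x).2.trans h12⟩

/-- [folklore] A common row bound for every fibre of a packed kernel from row bounds of the blocks. -/
theorem rowBound_fpack {B₁ B₂ B₃ B₄ : ℝ} (hA : ∀ a a', RowBound (Kfib A a a') B₁) (hB : ∀ a b', RowBound (Kfib B a b') B₂)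
    (hC : ∀ b a', RowBound (Kfib C b a') B₃) (hD : ∀ b b', RowBound (Kfib D b b') B₄) :
    ∀ i k, RowBound (Kfib (fpack A B C D) i k) (max (max B₁ B₂) (max B₃ B₄)) := by
  rintro (a | b) (a' | b')
  · exact rowBound_mono (hA a a') ((le_max_left _ _).trans (le_max_left _ _))
  · exact rowBound_mono (hB a b') ((le_max_right _ _).trans (le_max_left _ _))
  · exact rowBound_mono (hC b a') ((le_max_left _ _).trans (le_max_right _ _))
  · exact rowBound_mono (hD b b') ((le_max_right _ _).trans (le_max_right _ _))

/-- [folklore] The zero kernel has absolutely summable rows. -/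
theorem summable_abs_zeroF (a : α) (b : β) (x : Fin d → ℤ) :
    Summable fun y => |Kfib (fun _ _ => (0 : ℝ) : FKer d α β) a b x y| := by
  simp only [Kfib_apply, abs_zero]
  exact summable_zero

/-- [folklore] Fibres of the transpose have absolutely summable rows when the COLUMNS of the original fibres are absolutely summable. -/
theorem summable_abs_trF {Q : FKer d β α} (hQ : ∀ b a y, Summable fun x => |Kfib Q b a x y|) (a : α) (b : β) (x : Fin d → ℤ) :
    Summable fun y => |Kfib (trF Q) a b x y| :=
  hQ b a x

end Hyps

/-! ## §4 The bordered block-periodic Lemma 2.2.2 -/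

section Lemma222
variable {s : ℕ} [NeZero s]

/-- [our object] (abbreviation for statements) the block matrix of the periodised blocks of `K` on `(Site d s × α) ⊕ (Site d s × β)`. -/
def blocksHat (s : ℕ) [NeZero s] (K : FKer d (α ⊕ β) (α ⊕ β)) :
    Matrix ((Site d s × α) ⊕ (Site d s × β)) ((Site d s × α) ⊕ (Site d s × β)) ℝ :=
  Matrix.fromBlocks (Matrix.of (periodiseF s (fTL K))) (Matrix.of (periodiseF s (fTR K)))
    (Matrix.of (periodiseF s (fBL K))) (Matrix.of (periodiseF s (fBR K)))

/-- [folklore] `blocksHat` is the re-indexed periodisation of `K` itself. -/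
theorem blocksHat_eq_reindex (K : FKer d (α ⊕ β) (α ⊕ β)) :
    blocksHat s K = Matrix.reindex (Equiv.prodSumDistrib (Site d s) α β) (Equiv.prodSumDistrib (Site d s) α β)
      (Matrix.of (periodiseF s K)) := by
  rw [blocksHat, ← reindex_periodiseF_fpack, fpack_eta]

variable [Fintype α] [Fintype β] [DecidableEq α] [DecidableEq β]

/-- [folklore] **BORDERED LEMMA 2.2.2** (block-periodic, two sorts): if `compF T S = δ` on `ℤ^d × (α ⊕ β)` with the rows of `T` absolutely
summable and the fibres of `S` jointly `s`-periodic with a common row bound, then the torus BLOCK matrices are two-sided inverses: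
`T̂·Ŝ = 1 ∧ Ŝ·T̂ = 1` on `(Site d s × α) ⊕ (Site d s × β)`. -/
theorem lemma222_fpack {T S : FKer d (α ⊕ β) (α ⊕ β)} {B : ℝ}
    (hT : ∀ i k x, Summable fun y => |Kfib T i k x y|) (hS : ∀ i k, IsPeriodic₂ s (Kfib S i k))
    (hSB : ∀ i k, RowBound (Kfib S i k) B) (hTS : compF T S = kdeltaF) :
    blocksHat s T * blocksHat s S = 1 ∧ blocksHat s S * blocksHat s T = 1 := by
  obtain ⟨h1, h2⟩ := lemma222F hT hS hSB hTS
  set e := Equiv.prodSumDistrib (Site d s) α β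
  refine ⟨?_, ?_⟩
  · rw [blocksHat_eq_reindex, blocksHat_eq_reindex, Matrix.reindex_apply, Matrix.reindex_apply,
      Matrix.submatrix_mul_equiv, h1, Matrix.submatrix_one_equiv]
  · rw [blocksHat_eq_reindex, blocksHat_eq_reindex, Matrix.reindex_apply, Matrix.reindex_apply,
      Matrix.submatrix_mul_equiv, h2, Matrix.submatrix_one_equiv]

/-- [folklore] **IDENTIFICATION OF A TORUS BLOCK INVERSE**: under the hypotheses of `lemma222_fpack`, ANY right inverse `G` of the block matrix
`T̂` is the block matrix of the periodised blocks of `S` — however `G` was obtained (e.g. `Matrix.inv`, or a torus KKT solve). -/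
theorem eq_blocksHat_of_mul_eq_one {T S : FKer d (α ⊕ β) (α ⊕ β)} {B : ℝ}
    (hT : ∀ i k x, Summable fun y => |Kfib T i k x y|) (hS : ∀ i k, IsPeriodic₂ s (Kfib S i k))
    (hSB : ∀ i k, RowBound (Kfib S i k) B) (hTS : compF T S = kdeltaF)
    {G : Matrix ((Site d s × α) ⊕ (Site d s × β)) ((Site d s × α) ⊕ (Site d s × β)) ℝ} (hG : blocksHat s T * G = 1) :
    G = blocksHat s S := by
  have h2 := (lemma222_fpack hT hS hSB hTS).2
  calc G = (blocksHat s S * blocksHat s T) * G := by rw [h2, Matrix.one_mul]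
    _ = blocksHat s S := by rw [Matrix.mul_assoc, hG, Matrix.mul_one]

/-- [folklore] The same for a left inverse. -/
theorem eq_blocksHat_of_mul_eq_one' {T S : FKer d (α ⊕ β) (α ⊕ β)} {B : ℝ}
    (hT : ∀ i k x, Summable fun y => |Kfib T i k x y|) (hS : ∀ i k, IsPeriodic₂ s (Kfib S i k))
    (hSB : ∀ i k, RowBound (Kfib S i k) B) (hTS : compF T S = kdeltaF)
    {G : Matrix ((Site d s × α) ⊕ (Site d s × β)) ((Site d s × α) ⊕ (Site d s × β)) ℝ} (hG : G * blocksHat s T = 1) :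
    G = blocksHat s S := by
  have h1 := (lemma222_fpack hT hS hSB hTS).1
  calc G = G * (blocksHat s T * blocksHat s S) := by rw [h1, Matrix.mul_one]
    _ = blocksHat s S := by rw [← Matrix.mul_assoc, hG, Matrix.one_mul]

/-- [folklore] The inverse of the torus block matrix IS the block matrix of the periodised inverse blocks. -/
theorem blocksHat_inv {T S : FKer d (α ⊕ β) (α ⊕ β)} {B : ℝ}
    (hT : ∀ i k x, Summable fun y => |Kfib T i k x y|) (hS : ∀ i k, IsPeriodic₂ s (Kfib S i k))
    (hSB : ∀ i k, RowBound (Kfib S i k) B) (hTS : compF T S = kdeltaF) :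
    (blocksHat s T)⁻¹ = blocksHat s S :=
  Matrix.inv_eq_right_inv (lemma222_fpack hT hS hSB hTS).1

/-- [folklore] **KKT FORM OF THE BORDERED LEMMA 2.2.2**: for a form kernel `H` on the sort `α` and a constraint kernel `Q : β ← α` with a
two-sided `ℤ^d` inverse `S` of the bordered operator `fpack H Qᵀ Q 0` (`compF (fpack H (trF Q) Q 0) S = δ`; rows of `H`, `Q`, columns of `Q`
absolutely summable; fibres of `Q` jointly periodic; fibres of `S` jointly periodic with a row bound), the torus KKT matrix `kkt Ĥ Q̂` has the
two-sided inverse `blocksHat s S`. -/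
theorem kkt_periodiseF_mul_eq_one {H : FKer d α α} {Q : FKer d β α} {S : FKer d (α ⊕ β) (α ⊕ β)} {B : ℝ}
    (hH : ∀ a a' x, Summable fun y => |Kfib H a a' x y|) (hQr : ∀ b a x, Summable fun y => |Kfib Q b a x y|)
    (hQc : ∀ b a y, Summable fun x => |Kfib Q b a x y|) (hQp : ∀ b a, IsPeriodic₂ s (Kfib Q b a))
    (hS : ∀ i k, IsPeriodic₂ s (Kfib S i k)) (hSB : ∀ i k, RowBound (Kfib S i k) B)
    (hTS : compF (fpack H (trF Q) Q (fun _ _ => 0)) S = kdeltaF) :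
    kkt (Matrix.of (periodiseF s H)) (Matrix.of (periodiseF s Q)) * blocksHat s S = 1 ∧
      blocksHat s S * kkt (Matrix.of (periodiseF s H)) (Matrix.of (periodiseF s Q)) = 1 := by
  have hT := summable_abs_fpack hH (summable_abs_trF hQc) hQr (summable_abs_zeroF (d := d) (α := β) (β := β))
  have hk : kkt (Matrix.of (periodiseF s H)) (Matrix.of (periodiseF s Q)) = blocksHat s (fpack H (trF Q) Q (fun _ _ => 0)) := by
    rw [kkt_periodiseF H hQp, blocksHat_eq_reindex]
  rw [hk]
  exact lemma222_fpack hT hS hSB hTS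

/-- [folklore] **THE TORUS KKT INVERSE IS THE PERIODISED `ℤ^d` BORDERED INVERSE, BLOCK BY BLOCK**:
`(kkt Ĥ Q̂)⁻¹ = fromBlocks Ŝ₁₁ Ŝ₁₂ Ŝ₂₁ Ŝ₂₂` (hypotheses of `kkt_periodiseF_mul_eq_one`). -/
theorem kkt_periodiseF_inv {H : FKer d α α} {Q : FKer d β α} {S : FKer d (α ⊕ β) (α ⊕ β)} {B : ℝ}
    (hH : ∀ a a' x, Summable fun y => |Kfib H a a' x y|) (hQr : ∀ b a x, Summable fun y => |Kfib Q b a x y|)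
    (hQc : ∀ b a y, Summable fun x => |Kfib Q b a x y|) (hQp : ∀ b a, IsPeriodic₂ s (Kfib Q b a))
    (hS : ∀ i k, IsPeriodic₂ s (Kfib S i k)) (hSB : ∀ i k, RowBound (Kfib S i k) B)
    (hTS : compF (fpack H (trF Q) Q (fun _ _ => 0)) S = kdeltaF) :
    (kkt (Matrix.of (periodiseF s H)) (Matrix.of (periodiseF s Q)))⁻¹ = blocksHat s S :=
  Matrix.inv_eq_right_inv (kkt_periodiseF_mul_eq_one hH hQr hQc hQp hS hSB hTS).1

/-- [folklore] In particular the torus KKT matrix is invertible (`det ≠ 0` — the nondegeneracy hypotheses `hM` of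
`mixedVar_sliceTransfer_jets` for `M_T`, `N_T`). -/
theorem kkt_periodiseF_det_ne_zero {H : FKer d α α} {Q : FKer d β α} {S : FKer d (α ⊕ β) (α ⊕ β)} {B : ℝ}
    (hH : ∀ a a' x, Summable fun y => |Kfib H a a' x y|) (hQr : ∀ b a x, Summable fun y => |Kfib Q b a x y|)
    (hQc : ∀ b a y, Summable fun x => |Kfib Q b a x y|) (hQp : ∀ b a, IsPeriodic₂ s (Kfib Q b a))
    (hS : ∀ i k, IsPeriodic₂ s (Kfib S i k)) (hSB : ∀ i k, RowBound (Kfib S i k) B)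
    (hTS : compF (fpack H (trF Q) Q (fun _ _ => 0)) S = kdeltaF) :
    (kkt (Matrix.of (periodiseF s H)) (Matrix.of (periodiseF s Q))).det ≠ 0 := by
  have h := (kkt_periodiseF_mul_eq_one hH hQr hQc hQp hS hSB hTS).1
  intro h0
  have := congrArg Matrix.det h
  rw [Matrix.det_mul, h0, zero_mul, Matrix.det_one] at this
  exact zero_ne_one this

end Lemma222

end Summit.QuantumFields.BalabanUV.Beta.D1BFx.SortedKernels

end
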